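import Summits.QuantumAdvantage.AdviceFreeQNC0.CodegTwoStar
import HarnessLib

/-!
# Cell qa-qnc0 (rung F-S1, route RingFrame, crux α, line `tensor`): THEOREM E2, SHARP FORM —
# the `6m + 4` transversal and `costBoundCodegTwo : CostBoundCodegTwo`

Assembly of `CodegTwoStar.lean`: the row-syndrome space `V = K ⊕ C` (`K` = parity/point-sum kernel,
`dim C ≤ m + 1`); the kernel planes form a STAR or a TOP (`CodegTwoStar.star_or_top`), so a basis of `K`
is represented by planes through the origin covering `≤ 2m` points (STAR: `{0, c} ∪ ⋃_i {t_i, t_i + c}`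
with `dim K ≤ m − 1`; TOP: the `≤ 8` points of a `3`-space), and a basis of `C` by its leaders (`≤ 4`
points each): **every row coset has a representative on a set `Z` of `≤ 6m + 4` columns**
(`exists_transversal`, `m = d + 3 ≥ 4`; `d = 0`: all `8` columns), whence by the literature seat's
`exists_lift_of_transversal` the lift costs `≤ 2^{L−1}(6d + 22) = (3d + 11)·2^L`:
**`costBoundCodegTwo : CostBoundCodegTwo`** (qn-p2 ROUND-5 §2.2 / Sketch5 VERBATIM, ask R5-a).

The cell's theorem (planner qa-qnc0-p2 gen 5; prover qa-qnc0-prover gen 6, 2026-08-27; kit: qn-lit g10's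
E2-KIT).  WHAT THIS IS NOT: nothing on co-degree `≥ 3` (E3), `LiftOneU` (R1U for all co-degrees with one
constant), LOC, TRPlus, α or the separation.
-/

noncomputable section

namespace Summit.QuantumAdvantage.AdviceFreeQNC0

open Finset Module Matrix
open Literature.Computability.MetaComplexity Literature.Computability.MetaComplexity.Smolensky
open MeanLoad Syndrome2 CodegTwo LiftFromTransversal

namespace CodegTwoStar

variable {L d : ℕ} {X Y : BMat L (d + 3)} {w : ℕ}

/-! ### The kernel transversal -/

/-- In a STAR, a plane `span{x, y} ∋ c` has its four points among `{0, c, t, t + c}`,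
`t = (if c = x then y else x)`. -/
private theorem planePts_subset_star {x y c : Fin (d + 3) → ZMod 2} (hy : y ≠ 0) (hxy : x ≠ y)
    (hc : c ∈ Submodule.span (ZMod 2) (Set.range ![x, y])) (hc0 : c ≠ 0) :
    planePts x y ⊆ {toPt 0, toPt c} ∪ {toPt (if c = x then y else x), toPt ((if c = x then y else x) + c)} := by
  classical
  rw [mem_span_pair_iff] at hc
  intro v hv
  unfold planePts at hv
  simp only [Finset.mem_insert, Finset.mem_singleton, Finset.mem_union] at hv ⊢
  rcases hc with rfl | rfl | rfl | rfl
  · exact absurd rfl hc0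
  · rw [if_pos rfl, add_comm y c]
    tauto
  · rw [if_neg (Ne.symm hxy)]
    tauto
  · have hne : x + y ≠ x := fun h => hy (by
      have h' : x + (x + y) = x + x := by rw [h]
      rwa [← add_assoc, add_self_vec, zero_add] at h')
    rw [if_neg hne, show x + (x + y) = y by rw [← add_assoc, add_self_vec, zero_add]]
    tauto

/-- The points of a subspace of dimension `≤ 3` number at most `8`. -/
private theorem card_pts_le_eight (T : Submodule (ZMod 2) (Fin (d + 3) → ZMod 2))
    [FiniteDimensional (ZMod 2) T] [DecidablePred (· ∈ T)] (hT : finrank (ZMod 2) T ≤ 3) :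
    (univ.filter fun v : Fin (d + 3) → Bool => bvec v ∈ T).card ≤ 8 := by
  classical
  haveI : Fintype T := Fintype.ofFinite T
  have hcard : Fintype.card T = 2 ^ finrank (ZMod 2) T := by
    rw [Module.card_eq_pow_finrank (K := ZMod 2) (V := T), ZMod.card]
  have hinj : Function.Injective (fun v : {v // v ∈ univ.filter fun v : Fin (d + 3) → Bool => bvec v ∈ T} =>
      (⟨bvec v.1, (Finset.mem_filter.1 v.2).2⟩ : T)) := by
    intro v v' h
    apply Subtype.ext
    exact bvec_injective (congrArg Subtype.val h)
  have h := Fintype.card_le_of_injective _ hinj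
  rw [Fintype.card_coe, hcard] at h
  calc _ ≤ 2 ^ finrank (ZMod 2) T := h
    _ ≤ 2 ^ 3 := Nat.pow_le_pow_right (by norm_num) hT

/-- **THE KERNEL TRANSVERSAL**: a set `Z_K` of `≤ 2m` or `≤ 8` columns such that every kernel syndrome
has a `Z_K`-supported representative. -/
theorem exists_kernel_transversal (hX : LinCols X) (hY : RowsDeg d Y) (hdist : ∀ u, rowDist X Y u ≤ w)
    (hw4 : w ≤ 4) :
    ∃ ZK : Finset (Fin (d + 3) → Bool), (ZK.card ≤ 2 * (d + 3) ∨ ZK.card ≤ 8) ∧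
      ∀ k : kerV X, ∃ g : CubeFn (ZMod 2) (d + 3),
        syn2 g = ((k : V X) : Finset (Fin (d + 3)) → ZMod 2) ∧ ∀ v, g v ≠ 0 → v ∈ ZK := by
  classical
  set bK := Module.finBasis (ZMod 2) (kerV X) with hbK
  have hne : ∀ i, ((bK i : kerV X) : V X) ≠ 0 := fun i h => bK.ne_zero i (Subtype.ext h)
  let kidx : Fin (finrank (ZMod 2) (kerV X)) → KIdx X := fun i => ⟨(bK i : V X), (bK i).2, hne i⟩
  let xi := fun i => px X Y hX hY hdist hw4 (kidx i)
  let yi := fun i => py X Y hX hY hdist hw4 (kidx i)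
  set ZK : Finset (Fin (d + 3) → Bool) := univ.biUnion fun i => planePts (xi i) (yi i) with hZK
  set repK : kerV X →ₗ[ZMod 2] CubeFn (ZMod 2) (d + 3) := bK.constr (ZMod 2) fun i => indF (planePts (xi i) (yi i))
  refine ⟨ZK, ?_, fun k => ⟨repK k, ?_, fun v hv => ?_⟩⟩
  · -- the size of `Z_K`: STAR or TOP
    rcases star_or_top X Y hX hY hdist hw4 with ⟨c, hc0, hstar⟩ | ⟨T, hTfin, hT3, hTle⟩
    · left
      have hr := finrank_kerV_le_of_star X Y hX hY hdist hw4 hc0 hstar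
      have hsub : ZK ⊆ {toPt 0, toPt c} ∪ univ.biUnion fun i =>
          ({toPt (if c = xi i then yi i else xi i), toPt ((if c = xi i then yi i else xi i) + c)} : Finset _) := by
        intro v hv
        rw [hZK, Finset.mem_biUnion] at hv
        obtain ⟨i, _, hvi⟩ := hv
        obtain ⟨-, hy, hxy, -, -⟩ := pxy_spec X Y hX hY hdist hw4 (kidx i)
        have h := planePts_subset_star hy hxy (hstar (kidx i)) hc0 hvi
        rw [Finset.mem_union] at h ⊢
        rcases h with h | h
        · exact Or.inl h
        · exact Or.inr (Finset.mem_biUnion.2 ⟨i, Finset.mem_univ _, h⟩)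
      calc ZK.card ≤ ({toPt 0, toPt c} ∪ univ.biUnion fun i =>
            ({toPt (if c = xi i then yi i else xi i), toPt ((if c = xi i then yi i else xi i) + c)} :
              Finset _)).card := Finset.card_le_card hsub
        _ ≤ 2 + ∑ _i : Fin (finrank (ZMod 2) (kerV X)), 2 := by
            refine (Finset.card_union_le _ _).trans (add_le_add (Finset.card_le_two) ?_)
            exact Finset.card_biUnion_le.trans (Finset.sum_le_sum fun i _ => Finset.card_le_two)
        _ ≤ 2 * (d + 3) := by
            rw [Finset.sum_const, Finset.card_univ, Fintype.card_fin, smul_eq_mul]; omega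
    · right
      haveI := hTfin
      have hsub : ZK ⊆ univ.filter fun v : Fin (d + 3) → Bool => bvec v ∈ T := by
        intro v hv
        rw [hZK, Finset.mem_biUnion] at hv
        obtain ⟨i, _, hvi⟩ := hv
        rw [mem_planePts_iff] at hvi
        exact Finset.mem_filter.2 ⟨Finset.mem_univ _, hTle (kidx i) hvi⟩
      exact (Finset.card_le_card hsub).trans (card_pts_le_eight T hT3)
  · -- `repK k` has syndrome `k`
    have h : syn2.comp repK = (V X).subtype.comp (kerV X).subtype := by
      refine bK.ext fun i => ?_
      rw [LinearMap.comp_apply, LinearMap.comp_apply, Submodule.subtype_apply, Submodule.subtype_apply]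
      show syn2 (repK (bK i)) = _
      rw [Basis.constr_basis]
      exact (pxy_spec X Y hX hY hdist hw4 (kidx i)).2.2.2.2
    exact LinearMap.congr_fun h k
  · -- support
    by_contra hZ
    apply hv
    show (bK.constr (ZMod 2) fun i => indF (planePts (xi i) (yi i))) k v = 0
    rw [Basis.constr_apply_fintype, Finset.sum_apply]
    refine Finset.sum_eq_zero fun i _ => ?_
    have hvi : v ∉ planePts (xi i) (yi i) := fun h =>
      hZ (by rw [hZK]; exact Finset.mem_biUnion.2 ⟨i, Finset.mem_univ _, h⟩)
    simp [indF, hvi]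

/-! ### The full transversal -/

/-- **THE `6m + 4` TRANSVERSAL** (`d ≥ 1`; for `d = 0` all `8` columns): every row coset
`X(u,·) + RM(d, d+3)` has a representative supported on a set `Z` of `≤ 6d + 22` columns. -/
theorem exists_transversal (hX : LinCols X) (hY : RowsDeg d Y) (hdist : ∀ u, rowDist X Y u ≤ w) (hw4 : w ≤ 4) :
    ∃ Z : Finset (Fin (d + 3) → Bool), Z.card ≤ 6 * d + 22 ∧
      ∀ u, ∃ v : (Fin (d + 3) → Bool) → Bool, (∀ p, v p = true → p ∈ Z) ∧
        HasDeg (fun p => xor (X u p) (v p)) d := by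
  classical
  rcases Nat.eq_zero_or_pos d with hd | hd
  · -- `d = 0`: all columns, the leader itself
    refine ⟨univ, ?_, fun u => ⟨ldr X Y u, fun p _ => Finset.mem_univ _, ?_⟩⟩
    · rw [Finset.card_univ, Fintype.card_fun, Fintype.card_bool, Fintype.card_fin, hd]; norm_num
    · have h : (fun p => xor (X u p) (ldr X Y u p)) = Y u := by
        funext p; unfold ldr; cases X u p <;> cases Y u p <;> rfl
      rw [h]; exact hY u
  -- `d ≥ 1`: kernel transversal + complement leaders
  obtain ⟨ZK, hZK, hrepK⟩ := exists_kernel_transversal hX hY hdist hw4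
  obtain ⟨C, hKC⟩ := (kerV X).exists_isCompl
  set bC := Module.finBasis (ZMod 2) C with hbC
  -- `dim C ≤ m + 1`
  have hC : finrank (ZMod 2) C ≤ d + 3 + 1 := by
    have h1 := LinearMap.finrank_range_add_finrank_ker (parity1.domRestrict (V X))
    have h2 := Submodule.finrank_sup_add_finrank_inf_eq (kerV X) C
    rw [hKC.sup_eq_top, hKC.inf_eq_bot, finrank_top, finrank_bot] at h2
    have h3 : finrank (ZMod 2) (LinearMap.range (parity1.domRestrict (V X))) ≤ d + 3 + 1 := by
      refine (Submodule.finrank_le _).trans ?_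
      rw [Module.finrank_fintype_fun_eq_card, Fintype.card_option, Fintype.card_fin]
    have h4 : LinearMap.ker (parity1.domRestrict (V X)) = kerV X := rfl
    rw [h4] at h1
    omega
  -- leaders for the complement basis
  have hrow : ∀ j, ∃ u, syn2 (CodegTwo.rowZ X u) = ((bC j : C) : V X) := fun j => exists_row_of_mem_V hX ((bC j : C) : V X).2
  choose uC huC using hrow
  set ZC : Finset (Fin (d + 3) → Bool) := univ.biUnion fun j => leader X Y (uC j) with hZC
  set repC : C →ₗ[ZMod 2] CubeFn (ZMod 2) (d + 3) := bC.constr (ZMod 2) fun j => indF (leader X Y (uC j))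
  have hsynC : ∀ c : C, syn2 (repC c) = ((c : V X) : Finset (Fin (d + 3)) → ZMod 2) := by
    have h : syn2.comp repC = (V X).subtype.comp C.subtype := by
      refine bC.ext fun j => ?_
      rw [LinearMap.comp_apply, LinearMap.comp_apply, Submodule.subtype_apply, Submodule.subtype_apply]
      show syn2 (repC (bC j)) = _
      rw [Basis.constr_basis, ← syn2_rowZ hY, huC]
    exact fun c => LinearMap.congr_fun h c
  have hsuppC : ∀ c : C, ∀ v, repC c v ≠ 0 → v ∈ ZC := by
    intro c v hv
    by_contra hZ
    apply hv
    show (bC.constr (ZMod 2) fun j => indF (leader X Y (uC j))) c v = 0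
    rw [Basis.constr_apply_fintype, Finset.sum_apply]
    refine Finset.sum_eq_zero fun j _ => ?_
    have hvj : v ∉ leader X Y (uC j) := fun h =>
      hZ (by rw [hZC]; exact Finset.mem_biUnion.2 ⟨j, Finset.mem_univ _, h⟩)
    simp [indF, hvj]
  have hZC_card : ZC.card ≤ 4 * (d + 3 + 1) := by
    calc ZC.card ≤ ∑ j, (leader X Y (uC j)).card := Finset.card_biUnion_le
      _ ≤ ∑ _j : Fin (finrank (ZMod 2) C), 4 := Finset.sum_le_sum fun j _ => by
          rw [card_leader]; exact (hdist _).trans hw4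
      _ ≤ 4 * (d + 3 + 1) := by
          rw [Finset.sum_const, Finset.card_univ, Fintype.card_fin, smul_eq_mul]; nlinarith
  refine ⟨ZK ∪ ZC, ?_, fun u => ?_⟩
  · refine (Finset.card_union_le _ _).trans ?_
    rcases hZK with h | h <;> omega
  · -- decompose the row syndrome along `K ⊕ C`
    set s : V X := ⟨syn2 (CodegTwo.rowZ X u), syn2_rowZ_mem X u⟩ with hs
    have hmem : s ∈ kerV X ⊔ C := by rw [hKC.sup_eq_top]; exact Submodule.mem_top
    obtain ⟨k, hk, c, hc, hkc⟩ := Submodule.mem_sup.1 hmem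
    obtain ⟨gK, hgK, hgKZ⟩ := hrepK ⟨k, hk⟩
    set g : CubeFn (ZMod 2) (d + 3) := gK + repC ⟨c, hc⟩ with hg
    have hsyn : syn2 g = syn2 (CodegTwo.rowZ X u) := by
      rw [hg, map_add, hgK, hsynC]
      show ((k : V X) : Finset (Fin (d + 3)) → ZMod 2) + ((c : V X) : _) = _
      rw [← Submodule.coe_add, hkc]
    refine ⟨fun p => decide (g p = 1), fun p hp => ?_, ?_⟩
    · rw [Finset.mem_union]
      have hp' : decide (g p = 1) = true := hp
      rw [decide_eq_true_eq] at hp'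
      by_cases h1 : gK p ≠ 0
      · exact Or.inl (hgKZ p h1)
      · right
        push Not at h1
        refine hsuppC ⟨c, hc⟩ p ?_
        have : g p = gK p + repC ⟨c, hc⟩ p := rfl
        rw [hp', h1, zero_add] at this
        rw [← this]; exact one_ne_zero
    · show (fun p => if xor (X u p) (decide (g p = 1)) = true then (1 : ZMod 2) else 0) ∈
        lowDeg (ZMod 2) (d + 3) d
      have h : (fun p => if xor (X u p) (decide (g p = 1)) = true then (1 : ZMod 2) else 0) =
          CodegTwo.rowZ X u + g := by
        funext p
        rw [ind_xor, zmod2_ind_decide]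
        rfl
      rw [h, ← ker_syn2_eq_lowDeg d, LinearMap.mem_ker, map_add, hsyn]
      funext J
      simp only [Pi.add_apply, Pi.zero_apply, CharTwo.add_self_eq_zero]

end CodegTwoStar

/-! ### THEOREM E2, sharp form -/

/-- **THEOREM E2, SHARP FORM: `costBoundCodegTwo : CostBoundCodegTwo`** — at co-degree two every matrix
with linear columns whose rows are `4`-close to `RM(d, d+3)` is `(3d + 11)·2^L`-close to a matrix with
linear columns and rows in `RM(d, d+3)` (transversal `≤ 6m + 4`). -/
theorem costBoundCodegTwo : CostBoundCodegTwo := by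
  intro L d w hw4 X Y hX hY hdist
  rcases Nat.eq_zero_or_pos L with rfl | hLpos
  · -- `L = 0`: the only row index is `0`, where `X` vanishes; `W = X`
    refine ⟨X, hX, fun u => ?_, ?_⟩
    · have hu : u = fun _ => false := funext fun i => Fin.elim0 i
      subst hu
      show (fun v => if X (fun _ => false) v = true then (1 : ZMod 2) else 0) ∈ lowDeg (ZMod 2) (d + 3) d
      have h : (fun v => if X (fun _ => false) v = true then (1 : ZMod 2) else 0) = 0 :=
        funext fun v => by rw [hX.2 v]; rfl
      rw [h]
      exact Submodule.zero_mem _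
    · rw [hw_xorM_self]
      exact Nat.zero_le _
  obtain ⟨Z, hZ, H⟩ := CodegTwoStar.exists_transversal hX hY hdist hw4
  obtain ⟨W, hW, hWd, hcost⟩ := exists_lift_of_transversal Z hX H
  refine ⟨W, hW, hWd, hcost.trans ?_⟩
  have hpow : 2 ^ L = 2 * 2 ^ (L - 1) := by
    rw [← Nat.pow_succ']; congr 1; omega
  rw [hpow]
  calc 2 ^ (L - 1) * Z.card ≤ 2 ^ (L - 1) * (6 * d + 22) := Nat.mul_le_mul_left _ hZ
    _ = (3 * d + 11) * (2 * 2 ^ (L - 1)) := by ring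

end Summit.QuantumAdvantage.AdviceFreeQNC0

end
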